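import Literature.AnabelianGeometry.AbsoluteAnabelian.AbsTopIProp410Sub
import Literature.AnabelianGeometry.SemiGraphs.TemperedAnabelianWitness
import Literature.AnabelianGeometry.SemiGraphs.TemperedCurveDiscreteRankOneWitness

/-!
# FACT-LIST rows F-0255 `VerticialEdgeLikeCharacterized`, F-0256 `prop410_i_ii_pointer` — kernel status

PROOF-ONLY companion (abc-iut seat f-092, F fact-proving wave, rung LADDER-ABC:A2.C) of abc-iut-L4-t4's
`AbsTopITemperedCusps.lean` (p405354, FROZEN; imported through `AbsTopIProp410Sub.lean`, never edited or
restated) for the two FROZEN FACT-LIST rows of S. Mochizuki, *Topics in Absolute Anabelian Geometry I*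
[AbsTopI], Prop 4.10, manuscript p. 60 (lit key `paper:url-11ac98ba15fc`):

* **F-0255** `VerticialEdgeLikeCharacterized verticial edgeLike` — Prop 4.10 (iv) «The verticial
  (respectively, edge-like) subgroups of `H[l]` may be characterized ["group-theoretically"] as the maximal
  compact subgroups (respectively, nontrivial intersections of two distinct maximal compact subgroups) of
  `H[l]`», typed by t4 as a PREDICATE on abstract data `(H[l], verticial, edge-like)`;
* **F-0256** `prop410_i_ii_pointer X` — Prop 4.10 (i)/(ii) POINTER: `Function.Injective X.toHat ∧
  X.PiTempNormallyTerminal` for a tempered curve `X` of abc-iut-L3's interface.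

Both rows are `parametrised` schemata; a schema is consumable at NAMED INSTANCES only (plan R5), and no
theorem of the tree consumes either as a closed fact (consumer census: docstring mentions in
`AbsTopIProp410Sub.lean`, one `example` in `Summits/ABC/IUTFork/DAGL4v.lean`).  This file records their
complete kernel status AS TYPED:

1. F-0255.  The predicate PINS the pair `(verticial, edgeLike)` to ONE value per topological group `H[l]`:
   `verticialEdgeLikeCharacterized_iff_eq` (it is literally the conjunction of two equations whose
   right-hand sides are abc-iut-w5's `AbsTopI.Prop410.IsMaxCompactSubgroup` family and the family of
   nontrivial pairwise intersections), hence it HOLDS at the canonical instance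
   (`verticialEdgeLikeCharacterized_maxCompact`), any two instances coincide
   (`VerticialEdgeLikeCharacterized.unique`, `verticialEdgeLikeCharacterized_existsUnique`), and its
   UNIVERSAL CLOSURE IS FALSE: in a compact group the whole group is a maximal compact subgroup, so the
   declared verticial family cannot be empty (`not_verticialEdgeLikeCharacterized_empty`; closed form
   `not_forall_verticialEdgeLikeCharacterized`, at `H[l] := PUnit`).  The CONTENT of print (iv) — that the
   verticial subgroups OF THE GENUINE `H[l]` (decomposition groups of the vertices of `Γ_H`) are the maximal
   compact ones — is the kit-relative row `AbsTopI.Prop410.MaxCompactAreVerticial` (F-3064), untouched here.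
2. F-0256.  Conjunct (i) is the interface FIELD `TemperedCurve.toHat_injective` — PROVED for all data
   (`prop410_i_injective`); conjunct (ii) IS the by-design predicate `TemperedCurve.PiTempNormallyTerminal`
   ([SemiAnbd] Lemma 6.1 (iii), FACT-LIST F-1678, class «predicate/vocabulary»), so the pointer row is
   EQUIVALENT to F-1678 verbatim (`prop410_i_ii_pointer_iff`) and holds exactly where F-1678 is supplied
   (`prop410_i_ii_pointer_of_piTempNormallyTerminal`).  Nothing further is decidable from the interface.

Refuting the universal closure of a predicate on abstract data says nothing about print.  HONEST FRAMING:
statements about OUR typed forms of a refereed prerequisite paper; no bearing on, and no side taken on,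
[IUTchIII] Cor 3.12; typed ≠ proved; a FACT-LIST row is an assumption label, not an endorsement.
-/

noncomputable section

namespace Literature.AnabelianGeometry.AbsoluteAnabelian

open Literature.AnabelianGeometry.SemiGraphs

universe u

/-! ### F-0255 `VerticialEdgeLikeCharacterized` ([AbsTopI] Prop 4.10 (iv) p. 60) -/

section VerticialEdgeLike

variable {Hl : Type u} [Group Hl] [TopologicalSpace Hl]

/-- F-0255, unfolding: t4's `VerticialEdgeLikeCharacterized verticial edgeLike` is the conjunction of the
two EQUATIONS «`verticial` = the maximal compact subgroups of `H[l]`» (abc-iut-w5's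
`AbsTopI.Prop410.IsMaxCompactSubgroup`) and «`edgeLike` = the nontrivial intersections `V ⊓ W` of two
distinct members of `verticial`».  [AbsTopI] Prop 4.10 (iv) p. 60: «The verticial (respectively, edge-like)
subgroups of `H[l]` may be characterized ["group-theoretically"] as the maximal compact subgroups
(respectively, nontrivial intersections of two distinct maximal compact subgroups) of `H[l]`.»
[cite: MochizukiAbsTopI2012, Prop 4.10 (iv) p.60] -/
theorem verticialEdgeLikeCharacterized_iff_eq (verticial edgeLike : Set (Subgroup Hl)) :
    VerticialEdgeLikeCharacterized verticial edgeLike ↔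
      verticial = {V : Subgroup Hl | AbsTopI.Prop410.IsMaxCompactSubgroup V} ∧
        edgeLike = {A : Subgroup Hl | A ≠ ⊥ ∧ ∃ V ∈ verticial, ∃ W ∈ verticial, V ≠ W ∧ A = V ⊓ W} :=
  Iff.rfl

/-- F-0255, membership form: under the predicate, a subgroup is verticial iff it is a maximal compact
subgroup of `H[l]` ([AbsTopI] Prop 4.10 (iv) p. 60, verticial clause).
[cite: MochizukiAbsTopI2012, Prop 4.10 (iv) p.60] -/
theorem VerticialEdgeLikeCharacterized.mem_verticial_iff {verticial edgeLike : Set (Subgroup Hl)}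
    (h : VerticialEdgeLikeCharacterized verticial edgeLike) (V : Subgroup Hl) :
    V ∈ verticial ↔ AbsTopI.Prop410.IsMaxCompactSubgroup V := by
  rw [h.1]
  rfl

/-- F-0255, membership form: under the predicate, a subgroup is edge-like iff it is a nontrivial
intersection of two distinct maximal compact subgroups of `H[l]` ([AbsTopI] Prop 4.10 (iv) p. 60,
edge-like clause). [cite: MochizukiAbsTopI2012, Prop 4.10 (iv) p.60] -/
theorem VerticialEdgeLikeCharacterized.mem_edgeLike_iff {verticial edgeLike : Set (Subgroup Hl)}
    (h : VerticialEdgeLikeCharacterized verticial edgeLike) (A : Subgroup Hl) :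
    A ∈ edgeLike ↔ A ≠ ⊥ ∧ ∃ V W : Subgroup Hl, AbsTopI.Prop410.IsMaxCompactSubgroup V ∧
      AbsTopI.Prop410.IsMaxCompactSubgroup W ∧ V ≠ W ∧ A = V ⊓ W := by
  obtain ⟨hv, he⟩ := h
  subst hv he
  simp only [Set.mem_setOf_eq]
  constructor
  · rintro ⟨hA, V, hV, W, hW, hVW, rfl⟩
    exact ⟨hA, V, W, hV, hW, hVW, rfl⟩
  · rintro ⟨hA, V, W, hV, hW, hVW, rfl⟩
    exact ⟨hA, V, hV, W, hW, hVW, rfl⟩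

/-- F-0255, INSTANCE FORM (PROVED for every topological group `H[l]`): the predicate holds at the canonical
pair «maximal compact subgroups / nontrivial intersections of two distinct maximal compact subgroups» —
the pair the printed characterisation names ([AbsTopI] Prop 4.10 (iv) p. 60).
[cite: MochizukiAbsTopI2012, Prop 4.10 (iv) p.60] -/
theorem verticialEdgeLikeCharacterized_maxCompact :
    VerticialEdgeLikeCharacterized (Hl := Hl) {V | AbsTopI.Prop410.IsMaxCompactSubgroup V}
      {A | A ≠ ⊥ ∧ ∃ V ∈ {V : Subgroup Hl | AbsTopI.Prop410.IsMaxCompactSubgroup V},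
        ∃ W ∈ {V : Subgroup Hl | AbsTopI.Prop410.IsMaxCompactSubgroup V}, V ≠ W ∧ A = V ⊓ W} :=
  ⟨rfl, rfl⟩

/-- F-0255, UNIQUENESS (PROVED): two pairs `(verticial, edgeLike)` satisfying the predicate on the same
`H[l]` coincide — the predicate is a characterisation, i.e. it determines its arguments
([AbsTopI] Prop 4.10 (iv) p. 60 «may be characterized»). [cite: MochizukiAbsTopI2012, Prop 4.10 (iv) p.60] -/
theorem VerticialEdgeLikeCharacterized.unique {verticial edgeLike verticial' edgeLike' : Set (Subgroup Hl)}
    (h : VerticialEdgeLikeCharacterized verticial edgeLike)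
    (h' : VerticialEdgeLikeCharacterized verticial' edgeLike') :
    verticial = verticial' ∧ edgeLike = edgeLike' := by
  obtain ⟨hv, he⟩ := h
  obtain ⟨hv', he'⟩ := h'
  subst hv he hv' he'
  exact ⟨rfl, rfl⟩

/-- F-0255, EXISTENCE AND UNIQUENESS packaged (PROVED): for every topological group `H[l]` there is exactly
one pair `(verticial, edgeLike)` satisfying t4's predicate ([AbsTopI] Prop 4.10 (iv) p. 60).
[cite: MochizukiAbsTopI2012, Prop 4.10 (iv) p.60] -/
theorem verticialEdgeLikeCharacterized_existsUnique :
    ∃! ve : Set (Subgroup Hl) × Set (Subgroup Hl), VerticialEdgeLikeCharacterized ve.1 ve.2 := by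
  refine ⟨⟨_, _⟩, verticialEdgeLikeCharacterized_maxCompact, ?_⟩
  rintro ⟨v, e⟩ hve
  obtain ⟨hv, he⟩ := hve.unique (verticialEdgeLikeCharacterized_maxCompact (Hl := Hl))
  simp only [Prod.mk.injEq]
  exact ⟨hv, he⟩

/-- In a COMPACT group the whole group is a maximal compact subgroup.
[cite: MochizukiAbsTopI2012, Prop 4.10 (iv) p.60] -/
theorem isMaxCompactSubgroup_top [CompactSpace Hl] :
    AbsTopI.Prop410.IsMaxCompactSubgroup (⊤ : Subgroup Hl) :=
  ⟨isCompact_univ, fun _ _ hW => (top_le_iff.mp hW).symm⟩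

/-- F-0255, the universal closure FAILS at degenerate data: in a compact group `H[l]` the declared verticial
family cannot be EMPTY (the whole group is a maximal compact subgroup), so
`VerticialEdgeLikeCharacterized ∅ edgeLike` is false for every `edgeLike`.  (A predicate on abstract data
is consumable at named instances only; this says nothing about print's (iv), whose verticial subgroups are
the decomposition groups of the vertices of `Γ_H`.) [cite: MochizukiAbsTopI2012, Prop 4.10 (iv) p.60] -/
theorem not_verticialEdgeLikeCharacterized_empty [CompactSpace Hl] (edgeLike : Set (Subgroup Hl)) :
    ¬ VerticialEdgeLikeCharacterized (∅ : Set (Subgroup Hl)) edgeLike := by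
  intro h
  have hmem : (⊤ : Subgroup Hl) ∈ (∅ : Set (Subgroup Hl)) :=
    (h.mem_verticial_iff ⊤).mpr isMaxCompactSubgroup_top
  exact hmem

end VerticialEdgeLike

/-- **F-0255, UNIVERSAL CLOSURE REFUTED** (closed form, kernel): it is NOT the case that t4's predicate holds
for all data `(H[l], verticial, edgeLike)` — witness `H[l] := PUnit` (the trivial compact group),
`verticial := ∅`.  The row is a SCHEMA: its instance form `verticialEdgeLikeCharacterized_maxCompact` is
proved above for every `H[l]`; the printed content lives in `AbsTopI.Prop410.MaxCompactAreVerticial`.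
[cite: MochizukiAbsTopI2012, Prop 4.10 (iv) p.60] -/
theorem not_forall_verticialEdgeLikeCharacterized :
    ¬ ∀ (Hl : Type u) [Group Hl] [TopologicalSpace Hl] (verticial edgeLike : Set (Subgroup Hl)),
      VerticialEdgeLikeCharacterized verticial edgeLike :=
  fun h => not_verticialEdgeLikeCharacterized_empty (Hl := PUnit.{u + 1}) ∅ (h PUnit ∅ ∅)

/-! ### F-0256 `prop410_i_ii_pointer` ([AbsTopI] Prop 4.10 (i), (ii) p. 60) -/

section Pointer

variable {p : ℕ} [Fact p.Prime]

/-- F-0256, conjunct (i) PROVED for every datum of abc-iut-L3's interface: «the natural homomorphism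
`Π^{tp}_X → Π̂^{tp}_X ≅ π₁(X)` is injective» ([AbsTopI] Prop 4.10 (i) p. 60) is the interface FIELD
`TemperedCurve.toHat_injective` ([SemiAnbd] §6 p. 69 «natural injection»).
[cite: MochizukiAbsTopI2012, Prop 4.10 (i) p.60] -/
theorem prop410_i_injective (X : TemperedCurve p) : Function.Injective X.toHat :=
  X.toHat_injective

/-- **F-0256 ⟺ F-1678** (PROVED): the pointer row `prop410_i_ii_pointer X` is EQUIVALENT to the by-design
predicate `X.PiTempNormallyTerminal` ([SemiAnbd] Lemma 6.1 (iii) «`N_{Π_{X_K}}(Π^temp_{X_K}) = Π^temp_{X_K}`»,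
FACT-LIST F-1678) — its other conjunct is the interface field `toHat_injective`.  So F-0256 carries no
assumption beyond F-1678 ([AbsTopI] Prop 4.10 (ii) p. 60: «`Π^{tp}_X` is normally terminal in `Π̂^{tp}_X`»,
whose printed proof cites exactly [SemiAnbd] Lemma 6.1 (iii)). [cite: MochizukiAbsTopI2012, Prop 4.10 (ii) p.60] -/
theorem prop410_i_ii_pointer_iff (X : TemperedCurve p) :
    prop410_i_ii_pointer X ↔ X.PiTempNormallyTerminal :=
  ⟨fun h => h.2, fun h => ⟨X.toHat_injective, h⟩⟩

/-- F-0256 at the instances where F-1678 is supplied (CONDITIONAL form, PROVED): normal terminality of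
`Π^{tp}_X` in `Π̂^{tp}_X` gives the pointer row ([AbsTopI] Prop 4.10 (i), (ii) p. 60).
[cite: MochizukiAbsTopI2012, Prop 4.10 (ii) p.60] -/
theorem prop410_i_ii_pointer_of_piTempNormallyTerminal (X : TemperedCurve p)
    (h : X.PiTempNormallyTerminal) : prop410_i_ii_pointer X :=
  (prop410_i_ii_pointer_iff X).mpr h

/-- F-0256, projection (PROVED): the pointer row yields F-1678 ([AbsTopI] Prop 4.10 (ii) p. 60).
[cite: MochizukiAbsTopI2012, Prop 4.10 (ii) p.60] -/
theorem prop410_i_ii_pointer.piTempNormallyTerminal {X : TemperedCurve p} (h : prop410_i_ii_pointer X) :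
    X.PiTempNormallyTerminal :=
  h.2

end Pointer

/-! ### F-0256 / F-1678 at the degenerate inhabitant of the interface (appended, abc-iut-f-092) -/

section DegenerateModel

variable (p : ℕ) [Fact p.Prime]

/-- F-1678 AT A MODEL (PROVED): the degenerate inhabitant `TemperedCurve.degenerate p` of abc-iut-L3's
interface (abc-iut-c312-4's `TemperedAnabelianWitness.lean`: `Π^temp := G_{ℚ_p} =: Π̂`, `toHat = id`, no
closed points) IS normally terminal in its profinite completion — the image of `toHat` is all of `Π̂`, a
normal subgroup, whose normalizer is everything ([SemiAnbd] Lemma 6.1 (iii) p. 69 as typed by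
`TemperedCurve.PiTempNormallyTerminal`).  Consistency evidence for the by-design predicate only: the
inhabitant is not the tempered fundamental group of any curve. [cite: MochizukiSemiAnbd2006, Lem 6.1(iii) p.69] -/
theorem piTempNormallyTerminal_degenerate : (TemperedCurve.degenerate p).PiTempNormallyTerminal := by
  have hr : (TemperedCurve.degenerate p).toHat.toMonoidHom.range = ⊤ :=
    MonoidHom.range_eq_top.mpr fun x => ⟨x, rfl⟩
  unfold TemperedCurve.PiTempNormallyTerminal
  rw [hr]
  exact Subgroup.normalizer_eq_top (H := (⊤ : Subgroup (TemperedCurve.degenerate p).PiHat))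

/-- **F-0256 AT A MODEL (PROVED)**: the pointer row `prop410_i_ii_pointer` HOLDS at the degenerate inhabitant
`TemperedCurve.degenerate p` — so the row (equivalently F-1678, `prop410_i_ii_pointer_iff`) is SATISFIABLE as
typed; together with `prop410_i_ii_pointer_iff` this is the complete kernel status of F-0256: conjunct (i)
proved for all data, conjunct (ii) ≡ F-1678, jointly consistent ([AbsTopI] Prop 4.10 (i)/(ii) p. 60).  Not a
statement about any genuine `Π^{tp}_X`. [cite: MochizukiAbsTopI2012, Prop 4.10 (ii) p.60] -/
theorem prop410_i_ii_pointer_degenerate : prop410_i_ii_pointer (TemperedCurve.degenerate p) :=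
  prop410_i_ii_pointer_of_piTempNormallyTerminal _ (piTempNormallyTerminal_degenerate p)

/-- F-0256 is NOT vacuously quantified and has a model: `∃ X : TemperedCurve p, prop410_i_ii_pointer X`
(PROVED; [AbsTopI] Prop 4.10 (i)/(ii) p. 60 at the consistency witness of the interface).
[cite: MochizukiAbsTopI2012, Prop 4.10 (ii) p.60] -/
theorem exists_prop410_i_ii_pointer : ∃ X : TemperedCurve p, prop410_i_ii_pointer X :=
  ⟨TemperedCurve.degenerate p, prop410_i_ii_pointer_degenerate p⟩

end DegenerateModel

/-! ### F-0256 / F-1678: the universal closure over the interface is FALSE (appended, abc-iut-f-092) -/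

section ClosureRefuted

variable (p : ℕ) [Fact p.Prime]

/-- **F-0256, UNIVERSAL CLOSURE REFUTED** (kernel): NOT every inhabitant of abc-iut-L3's interface
`TemperedCurve p` satisfies the pointer row `prop410_i_ii_pointer` — by `prop410_i_ii_pointer_iff` this is
the failure of F-1678 `PiTempNormallyTerminal` at abc-iut-w6-d028's rank-one abelian inhabitant
(`SemiGraphs.not_forall_piTempNormallyTerminal`, `TemperedCurveDiscreteRankOneWitness.lean`: `Π^temp :=
ℤ × G_{ℚ_p}` discrete rank one, `Π := Ẑ × G_{ℚ_p}`, `N_Π(Π^temp) = Π ≠ Π^temp`).  With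
`prop410_i_ii_pointer_degenerate` the row takes BOTH truth values on the interface: it is consumable at
NAMED (certified) instances only — [AbsTopI] Prop 4.10 (ii) p. 60 concerns the genuine `Π^{tp}_X`.
[cite: MochizukiAbsTopI2012, Prop 4.10 (ii) p.60] -/
theorem not_forall_prop410_i_ii_pointer : ¬ ∀ X : TemperedCurve p, prop410_i_ii_pointer X :=
  fun h => SemiGraphs.not_forall_piTempNormallyTerminal p fun X => (h X).2

/-- F-0256 has a counter-inhabitant: `∃ X : TemperedCurve p, ¬ prop410_i_ii_pointer X` (PROVED; the
negation of the universal closure, made existential). [cite: MochizukiAbsTopI2012, Prop 4.10 (ii) p.60] -/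
theorem exists_not_prop410_i_ii_pointer : ∃ X : TemperedCurve p, ¬ prop410_i_ii_pointer X :=
  not_forall.mp (not_forall_prop410_i_ii_pointer p)

/-- **F-0256 is INDEPENDENT of the interface** (PROVED): the pointer row holds at one inhabitant of
`TemperedCurve p` (`TemperedCurve.degenerate p`) and fails at another (w6-d028's rank-one datum) — the
complete kernel status of the row as typed, together with `prop410_i_ii_pointer_iff` (≡ F-1678) and
`prop410_i_injective` (conjunct (i) for all data). [cite: MochizukiAbsTopI2012, Prop 4.10 (ii) p.60] -/
theorem prop410_i_ii_pointer_independent :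
    (∃ X : TemperedCurve p, prop410_i_ii_pointer X) ∧ ∃ X : TemperedCurve p, ¬ prop410_i_ii_pointer X :=
  ⟨exists_prop410_i_ii_pointer p, exists_not_prop410_i_ii_pointer p⟩

end ClosureRefuted

end Literature.AnabelianGeometry.AbsoluteAnabelian

end
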